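import Literature.NumberTheory.LFunctions.NymanBeurlingBaezDuarteProofs
import HarnessLib

/-!
# RH-EQUIVALENT·SPLITTING CENSUS (nb, neg) · V39 «TARGETS»: Nyman–Beurling approximation of targets other than `χ` — the zero-CONFINEMENT law, a family of one-cell RH-equivalents, and the target axis polarised; nothing here bears on the truth of RH

LABEL (line 1): RH-EQUIVALENT·SPLITTING (cell `rh-split`, seat (nb, neg), generation 14, census
candidate V39).  Every earlier census row (V1–V38) approximates the SAME target `χ = 𝟙_(0,1]`.
This file changes the TARGET: for a real function `f ∈ L²(0,∞)` supported in `(0,1]`, write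
TARGET(f) for «`f` lies in the `L²(0,∞)`-closure of the real span of `x ↦ {1/(kx)}`, `k ≥ 1`»
(spelled out in `ε`-form, exactly as in `Literature.NumberTheory.LFunctions.baezDuarte_iff`).

* `mellin_eq_zero_of_nbTarget` (ZERO CONFINEMENT, RH-free): TARGET(f) forces the Mellin
  transform `∫_0^1 f(x) x^{s-1} dx` to VANISH at every zero `s` of `ζ` with `1/2 < Re s < 1`
  (the `L²(0,∞)` form, for arbitrary targets, of the elementary half of Báez-Duarte's theorem;
  in print for Báez-Duarte's system: Balazard, arXiv:1812.04309, Prop. 11 «f ∈ B̄ ⟹ F/ζ holomorphic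
  on σ > 1/2»; for Beurling's continuum system the converse holds too: Bercovici–Foias 1984).
* `riemannHypothesis_of_nbTarget` (the splitting shape FIN_f ∧ TARGET(f) ⟹ RH): if moreover `ζ`
  does not vanish on the strip zeros of the Mellin transform of `f` (the would-be finite conjunct
  FIN_f), RH follows.
* `riemannHypothesis_of_nbTarget_indicator` : for every `0 < a < b ≤ 1`, TARGET(`𝟙_(a,b]`) ⟹ RH —
  the Mellin transform `(b^s - a^s)/s` has all its zeros on `Re s = 0`, so FIN is EMPTY: a family of
  Nyman–Beurling criteria with one-cell targets (for `(a,b] = (1/(m+1), 1/m]` the converse holds,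
  Báez-Duarte/Balazard «B̄ = D ⟺ RH»; see `nbTarget_cell_of_rh` in the companion file).
* `riemannHypothesis_of_nbTarget_indicator_zero` : the same for the initial segments `𝟙_(0,b]`,
  `0 < b ≤ 1` (Mellin transform `b^s/s`); `b = 1` is the elementary half of Báez-Duarte's theorem,
  `b = 1/m` pairs with `nbTarget_indicator_of_rh` (companion file `NbTargetsDilation.lean`) to the
  RH-EQUIVALENT «`𝟙_(0,1/m] ∈ B̄`», `m ≥ 1`.

Hygiene: zero `def`s, no `sorry`, no new axioms, no `instance`/`notation`, imports = the landed
`Literature.NumberTheory.LFunctions.NymanBeurlingBaezDuarteProofs` + `HarnessLib`.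
-/

set_option linter.dupNamespace false

noncomputable section

open Complex Filter MeasureTheory Set
open scoped Real Topology

namespace Summit.RiemannHypothesis.RiemannHypothesis.Theorems.Splittings.NbTargets

open Literature.NumberTheory.LFunctions

/-- **ZERO CONFINEMENT (RH-free).**  Let `f : ℝ → ℝ` be measurable, square-integrable on `(0,∞)`
and zero on `(1,∞)`.  If `f` is an `L²(0,∞)`-limit of real combinations
`∑_{k<N} c_k {1/((k+1)x)}` (TARGET(f)), then `∫_0^∞ f(x) x^{s-1} dx = 0` at every zero `s` of `ζ`
with `1/2 < Re s < 1`.  Proof (as in the tree's `riemannHypothesis_of_beurling_closure`): on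
`(1,∞)` an approximant equals `C/x`, `C = ∑ c_k/(k+1)`, so `|C| ≤ ε`; pairing `f - ∑ c_k ρ_{k+1}`
with `x^{s-1}𝟙_(0,1]` gives `mellin f s - C/(s-1)` (Titchmarsh (2.1.5) at a zero:
`∫_0^1 {1/(kx)}x^{s-1}dx = 1/(k(s-1))`), of modulus `≤ ε‖x^{s-1}‖_{L²(0,1)}`; let `ε → 0`.
[cite: Balazard2020, Prop. 11; BaezDuarte2003, Thm. 1.1] -/
theorem mellin_eq_zero_of_nbTarget {f : ℝ → ℝ} (hfm : Measurable f)
    (hf2 : MemLp f 2 (volume.restrict (Ioi 0)))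
    (hf1 : ∀ x, 1 < x → f x = 0)
    (h : ∀ ε : ℝ, 0 < ε → ∃ (N : ℕ) (c : Fin N → ℝ),
      eLpNorm (fun x : ℝ ↦ f x -
          ∑ k : Fin N, c k * Int.fract (1 / (((k : ℕ) + 1 : ℝ) * x))) 2
        (volume.restrict (Ioi 0)) < ENNReal.ofReal ε)
    {s : ℂ} (hζ : riemannZeta s = 0) (hσ : 1 / 2 < s.re) (hσ1 : s.re < 1) :
    mellin (fun x ↦ (f x : ℂ)) s = 0 := by
  set μ0 : Measure ℝ := volume.restrict (Ioi 0) with hμ0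
  have hre : 0 < s.re := by linarith
  have hs1 : s ≠ 1 := fun h' ↦ by simp [h'] at hσ1
  -- the test function `g = 𝟙_{(0,1]} x^{s-1}` and its (finite) `L²` norm `M`
  set g : ℝ → ℂ := (Ioc (0 : ℝ) 1).indicator fun x ↦ (x : ℂ) ^ (s - 1) with hg
  have hgm : AEStronglyMeasurable g μ0 := by
    refine (Measurable.indicator ?_ measurableSet_Ioc).aestronglyMeasurable
    exact Complex.measurable_ofReal.pow_const _
  have hgL2 : MemLp g 2 μ0 := by
    refine (memLp_two_iff_integrable_sq_norm hgm).2 ?_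
    have hI : IntegrableOn (fun x : ℝ ↦ x ^ (2 * (s.re - 1))) (Ioc 0 1) μ0 :=
      (intervalIntegral.intervalIntegrable_rpow' (a := 0) (b := 1) (by linarith)).1.restrict
    refine (hI.integrable_indicator measurableSet_Ioc).congr ?_
    filter_upwards [ae_restrict_mem measurableSet_Ioi] with x (hx : 0 < x)
    by_cases hx1 : x ∈ Ioc (0 : ℝ) 1
    · simp only [hg, indicator_of_mem hx1, norm_cpow_eq_rpow_re_of_pos hx, sub_re, one_re]
      rw [← Real.rpow_natCast, ← Real.rpow_mul hx.le]
      norm_num [mul_comm]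
    · simp [hg, indicator_of_notMem hx1]
  set M : ℝ := (eLpNorm g 2 μ0).toReal with hM
  have hM0 : 0 ≤ M := ENNReal.toReal_nonneg
  -- the target in complex clothes, and its Mellin integrand
  set F : ℝ → ℂ := (Ioc (0 : ℝ) 1).indicator fun x ↦ (f x : ℂ) with hF
  have hF_eq : ∀ x : ℝ, 0 < x → F x = (f x : ℂ) := by
    intro x hx
    by_cases hx1 : x ∈ Ioc (0 : ℝ) 1
    · rw [hF, indicator_of_mem hx1]
    · have h1x : 1 < x := not_le.1 fun h' ↦ hx1 ⟨hx, h'⟩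
      rw [hF, indicator_of_notMem hx1, hf1 x h1x, Complex.ofReal_zero]
  have hFL2 : MemLp F 2 μ0 := by
    have : MemLp (fun x ↦ (f x : ℂ)) 2 μ0 := hf2.ofReal
    exact MemLp.indicator measurableSet_Ioc this
  have hprodF : (fun x : ℝ ↦ (x : ℂ) ^ (s - 1) • F x) = F * g := by
    funext x
    simp only [Pi.mul_apply, smul_eq_mul, hF, hg]
    by_cases hx : x ∈ Ioc (0 : ℝ) 1
    · simp only [indicator_of_mem hx]; ring
    · simp only [indicator_of_notMem hx, mul_zero]
  have hintF : Integrable (fun x : ℝ ↦ (x : ℂ) ^ (s - 1) • F x) μ0 := by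
    rw [hprodF]
    exact memLp_one_iff_integrable.1 (hgL2.mul' hFL2)
  have hmellin : mellin (fun x ↦ (f x : ℂ)) s = ∫ x in Ioi (0 : ℝ), (x : ℂ) ^ (s - 1) • F x := by
    rw [mellin]
    refine setIntegral_congr_fun measurableSet_Ioi fun x (hx : 0 < x) ↦ ?_
    simp only [hF_eq x hx]
  -- Key estimate: for every `ε > 0`, `‖mellin f s‖ ≤ ε (M + ‖1/(s-1)‖)`.
  have key : ∀ ε : ℝ, 0 < ε → ‖mellin (fun x ↦ (f x : ℂ)) s‖ ≤ ε * (M + ‖(1 : ℂ) / (s - 1)‖) := by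
    intro ε hε
    obtain ⟨N, c, hN⟩ := h ε hε
    set D : ℝ → ℝ := fun x ↦ f x -
      ∑ k : Fin N, c k * Int.fract (1 / (((k : ℕ) + 1 : ℝ) * x)) with hD
    have hDm : Measurable D := by
      refine hfm.sub (Finset.measurable_sum _ fun k _ ↦ ?_)
      exact measurable_const.mul (measurable_fract.comp (by fun_prop))
    set C : ℝ := ∑ k : Fin N, c k / ((k : ℕ) + 1) with hC
    ------------------------------------------------------------------
    -- (i) the tail `x > 1` gives `|C| ≤ ε`
    ------------------------------------------------------------------
    have hDtail : ∀ x : ℝ, 1 < x → D x = -C * x⁻¹ := by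
      intro x hx
      have hx0 : 0 < x := by linarith
      simp only [hD, hf1 x hx, zero_sub, hC, neg_mul, Finset.sum_mul, neg_inj]
      refine Finset.sum_congr rfl fun k _ ↦ ?_
      have hk : (0 : ℝ) < (k : ℕ) + 1 := by positivity
      rw [Int.fract_eq_self.2 ⟨by positivity, ?_⟩]
      · field_simp
      · rw [div_lt_one (by positivity)]; nlinarith
    have hCε : |C| ≤ ε := by
      have h1 : eLpNorm D 2 (volume.restrict (Ioi 1)) < ENNReal.ofReal ε :=
        (eLpNorm_mono_measure D (Measure.restrict_mono_set _ (Ioi_subset_Ioi zero_le_one))).trans_lt hN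
      have h2 : eLpNorm D 2 (volume.restrict (Ioi 1)) =
          eLpNorm ((-C) • fun x : ℝ ↦ x⁻¹) 2 (volume.restrict (Ioi 1)) := by
        refine eLpNorm_congr_ae ?_
        filter_upwards [ae_restrict_mem measurableSet_Ioi] with x hx
        rw [hDtail x hx, Pi.smul_apply, smul_eq_mul]
      rw [h2, eLpNorm_const_smul, eLpNorm_inv_Ioi_one, mul_one, enorm_neg,
        Real.enorm_eq_ofReal_abs, ENNReal.ofReal_lt_ofReal_iff hε] at h1
      exact h1.le
    ------------------------------------------------------------------
    -- (ii) the pairing with `x^{s-1}` on `(0,1]` equals `mellin f s - C/(s-1)`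
    ------------------------------------------------------------------
    set Dc : ℝ → ℂ := (Ioc (0 : ℝ) 1).indicator fun x ↦ (D x : ℂ) with hDc
    have hDcm : Measurable Dc := (Complex.measurable_ofReal.comp hDm).indicator measurableSet_Ioc
    have hDc_eq : ∀ x : ℝ, Dc x = F x -
        ∑ k : Fin N, (c k : ℂ) * beurlingRhoTrunc ((k : ℕ) + 1) x := by
      intro x
      by_cases hx : x ∈ Ioc (0 : ℝ) 1
      · simp only [hDc, hD, hF, beurlingRhoTrunc, indicator_of_mem hx]
        push_cast
        rfl
      · simp only [hDc, hF, beurlingRhoTrunc, indicator_of_notMem hx, mul_zero,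
          Finset.sum_const_zero, sub_zero]
    have hmel : ∀ k : Fin N, mellin (beurlingRhoTrunc ((k : ℕ) + 1)) s =
        1 / ((((k : ℕ) : ℂ) + 1) * (s - 1)) := by
      intro k
      have := mellin_beurlingRhoTrunc_eq (k := (k : ℕ) + 1) (by simp) hre hs1
      rw [this, hζ, mul_zero, zero_div, sub_zero]
      push_cast
      ring
    have hI : ∫ x in Ioi (0 : ℝ), (x : ℂ) ^ (s - 1) • Dc x =
        mellin (fun x ↦ (f x : ℂ)) s - C / (s - 1) := by
      have hlin : (fun x : ℝ ↦ (x : ℂ) ^ (s - 1) • Dc x) = fun x : ℝ ↦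
          (x : ℂ) ^ (s - 1) • F x -
            ∑ k : Fin N, (c k : ℂ) * ((x : ℂ) ^ (s - 1) • beurlingRhoTrunc ((k : ℕ) + 1) x) := by
        funext x
        rw [hDc_eq, smul_eq_mul, smul_eq_mul, mul_sub, Finset.mul_sum]
        congr 1
        exact Finset.sum_congr rfl fun k _ ↦ by rw [smul_eq_mul]; ring
      have hint2 : ∀ k : Fin N, Integrable (fun x : ℝ ↦ (c k : ℂ) *
          ((x : ℂ) ^ (s - 1) • beurlingRhoTrunc ((k : ℕ) + 1) x)) μ0 :=
        fun k ↦ (mellinConvergent_beurlingRhoTrunc _ hre).const_mul _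
      rw [hlin, integral_sub hintF (integrable_finsetSum _ fun k _ ↦ hint2 k),
        integral_finsetSum _ fun k _ ↦ hint2 k, ← hmellin]
      have h2 : ∀ k : Fin N, ∫ x in Ioi (0 : ℝ), (x : ℂ) ^ (s - 1) •
          beurlingRhoTrunc ((k : ℕ) + 1) x = 1 / ((((k : ℕ) : ℂ) + 1) * (s - 1)) :=
        fun k ↦ hmel k
      rw [Finset.sum_congr rfl fun k _ ↦
        (integral_const_mul _ _).trans (congrArg (fun z ↦ (c k : ℂ) * z) (h2 k))]
      rw [hC]
      push_cast
      rw [Finset.sum_div]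
      congr 1
      refine Finset.sum_congr rfl fun k _ ↦ ?_
      have hk : (((k : ℕ) : ℂ) + 1) ≠ 0 := by exact_mod_cast Nat.succ_ne_zero k
      have hs2 : s - 1 ≠ 0 := sub_ne_zero.2 hs1
      field_simp
    ------------------------------------------------------------------
    -- (iii) Cauchy–Schwarz on `(0,1]`: the pairing has norm `≤ ε M`
    ------------------------------------------------------------------
    have hIle : ‖∫ x in Ioi (0 : ℝ), (x : ℂ) ^ (s - 1) • Dc x‖ ≤ ε * M := by
      have hprod : (fun x : ℝ ↦ (x : ℂ) ^ (s - 1) • Dc x) = Dc • g := by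
        funext x
        simp only [Pi.smul_apply', smul_eq_mul, hDc, hg]
        by_cases hx : x ∈ Ioc (0 : ℝ) 1
        · simp only [indicator_of_mem hx]; ring
        · simp only [indicator_of_notMem hx, mul_zero]
      have hDc2 : eLpNorm Dc 2 μ0 ≤ ENNReal.ofReal ε := by
        refine (eLpNorm_mono fun x ↦ ?_).trans hN.le
        simp only [hDc]
        refine (norm_indicator_le_norm_self _ _).trans ?_
        rw [Complex.norm_real]
      have hH : eLpNorm (Dc • g) 1 μ0 ≤ ENNReal.ofReal ε * eLpNorm g 2 μ0 :=
        (eLpNorm_smul_le_mul_eLpNorm hgm hDcm.aestronglyMeasurable).trans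
          (by gcongr)
      have hfin : ENNReal.ofReal ε * eLpNorm g 2 μ0 ≠ ⊤ :=
        ENNReal.mul_ne_top ENNReal.ofReal_ne_top hgL2.eLpNorm_lt_top.ne
      calc ‖∫ x in Ioi (0 : ℝ), (x : ℂ) ^ (s - 1) • Dc x‖
          ≤ (∫⁻ x in Ioi (0 : ℝ), ENNReal.ofReal ‖(x : ℂ) ^ (s - 1) • Dc x‖).toReal :=
            norm_integral_le_lintegral_norm _
        _ = (eLpNorm (Dc • g) 1 μ0).toReal := by
            rw [← hprod, eLpNorm_one_eq_lintegral_enorm]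
            simp_rw [ofReal_norm]
            rfl
        _ ≤ (ENNReal.ofReal ε * eLpNorm g 2 μ0).toReal := ENNReal.toReal_mono hfin hH
        _ = ε * M := by rw [ENNReal.toReal_mul, ENNReal.toReal_ofReal hε.le]
    ------------------------------------------------------------------
    -- combine
    ------------------------------------------------------------------
    have hCn : ‖(C : ℂ) / (s - 1)‖ ≤ ε * ‖(1 : ℂ) / (s - 1)‖ := by
      rw [norm_div, norm_div, norm_one, Complex.norm_real, Real.norm_eq_abs, ← div_eq_mul_one_div]
      exact div_le_div_of_nonneg_right hCε (norm_nonneg _)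
    calc ‖mellin (fun x ↦ (f x : ℂ)) s‖
        = ‖(mellin (fun x ↦ (f x : ℂ)) s - C / (s - 1)) + C / (s - 1)‖ := by rw [sub_add_cancel]
      _ ≤ ‖mellin (fun x ↦ (f x : ℂ)) s - C / (s - 1)‖ + ‖(C : ℂ) / (s - 1)‖ := norm_add_le _ _
      _ ≤ ε * M + ε * ‖(1 : ℂ) / (s - 1)‖ := add_le_add (hI ▸ hIle) hCn
      _ = ε * (M + ‖(1 : ℂ) / (s - 1)‖) := by ring
  -- Conclusion: `‖mellin f s‖ = 0`.
  by_contra hne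
  have hpos : 0 < ‖mellin (fun x ↦ (f x : ℂ)) s‖ := norm_pos_iff.2 hne
  set K : ℝ := M + ‖(1 : ℂ) / (s - 1)‖ with hK
  have hK0 : 0 ≤ K := by positivity
  have := key (‖mellin (fun x ↦ (f x : ℂ)) s‖ / (2 * (K + 1))) (by positivity)
  have hlt : ‖mellin (fun x ↦ (f x : ℂ)) s‖ / (2 * (K + 1)) * K <
      ‖mellin (fun x ↦ (f x : ℂ)) s‖ := by
    rw [div_mul_eq_mul_div, div_lt_iff₀ (by positivity)]
    nlinarith
  linarith

/-- **The splitting shape FIN_f ∧ TARGET(f) ⟹ RH (RH-free implication).**  For a target `f`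
(measurable, `L²(0,∞)`, zero on `(1,∞)`): if `ζ` has no zero `s` with `1/2 < Re s < 1` at which the
Mellin transform of `f` vanishes (FIN_f — a FINITE certificate exactly when the strip zero set of
`s ↦ ∫_0^1 f x^{s-1}` is a known finite set) and `f` is Nyman–Beurling approximable (TARGET(f)),
then the Riemann hypothesis holds.  `mellin_eq_zero_of_nbTarget` plus the functional equation
(`Literature.NumberTheory.LFunctions.quasiRiemannHypothesis_one_half_iff_holds`).  For `f = χ`
this is the elementary half of Báez-Duarte's theorem (FIN_χ is empty: `mellin χ s = 1/s ≠ 0`).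
[cite: BaezDuarte2003, Thm. 1.1; Balazard2020, Prop. 10 (i), Prop. 11] -/
theorem riemannHypothesis_of_nbTarget {f : ℝ → ℝ} (hfm : Measurable f)
    (hf2 : MemLp f 2 (volume.restrict (Ioi 0)))
    (hf1 : ∀ x, 1 < x → f x = 0)
    (hfin : ∀ s : ℂ, 1 / 2 < s.re → s.re < 1 → mellin (fun x ↦ (f x : ℂ)) s = 0 →
      riemannZeta s ≠ 0)
    (h : ∀ ε : ℝ, 0 < ε → ∃ (N : ℕ) (c : Fin N → ℝ),
      eLpNorm (fun x : ℝ ↦ f x -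
          ∑ k : Fin N, c k * Int.fract (1 / (((k : ℕ) + 1 : ℝ) * x))) 2
        (volume.restrict (Ioi 0)) < ENNReal.ofReal ε) :
    RiemannHypothesis :=
  quasiRiemannHypothesis_one_half_iff_holds.1 fun s hζ hσ hσ1 ↦
    hfin s hσ hσ1 (mellin_eq_zero_of_nbTarget hfm hf2 hf1 h hζ hσ hσ1) hζ

/-- Mellin transform of a one-cell target: `∫_0^∞ 𝟙_(a,b](x) x^{s-1} dx = (b^s - a^s)/s` for
`0 < a < b` and `0 < Re s`. [folklore] -/
theorem mellin_indicator_Ioc {a b : ℝ} (ha : 0 < a) (hab : a < b) {s : ℂ} (hs : 0 < s.re) :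
    mellin (fun x ↦ (((Ioc a b).indicator 1 x : ℝ) : ℂ)) s = ((b : ℂ) ^ s - (a : ℂ) ^ s) / s := by
  have hb : 0 < b := ha.trans hab
  have hdiff : Ioc (0 : ℝ) b \ Ioc 0 a = Ioc a b := by
    ext x
    rw [Set.mem_sdiff, mem_Ioc, mem_Ioc, mem_Ioc]
    constructor
    · rintro ⟨⟨h0, hxb⟩, hna⟩
      exact ⟨not_le.1 fun hxa ↦ hna ⟨h0, hxa⟩, hxb⟩
    · rintro ⟨hax, hxb⟩
      exact ⟨⟨ha.trans hax, hxb⟩, fun h' ↦ absurd h'.2 (not_le.2 hax)⟩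
  have hfun : (fun x ↦ (((Ioc a b).indicator 1 x : ℝ) : ℂ)) =
      fun x ↦ (Ioc (0 : ℝ) b).indicator (fun _ ↦ (1 : ℂ)) x -
        (Ioc (0 : ℝ) a).indicator (fun _ ↦ (1 : ℂ)) x := by
    have hsub : (Ioc (0 : ℝ) b).indicator (fun _ ↦ (1 : ℂ)) - (Ioc (0 : ℝ) a).indicator (fun _ ↦ (1 : ℂ))
        = (Ioc a b).indicator fun _ ↦ (1 : ℂ) := by
      rw [← hdiff, indicator_sdiff (Ioc_subset_Ioc_right hab.le)]
    funext x
    have hx := congrFun hsub x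
    simp only [Pi.sub_apply] at hx
    rw [hx]
    by_cases hxI : x ∈ Ioc a b
    · rw [indicator_of_mem hxI, indicator_of_mem hxI, Pi.one_apply, Complex.ofReal_one]
    · rw [indicator_of_notMem hxI, indicator_of_notMem hxI, Complex.ofReal_zero]
  rw [hfun]
  have h1 := hasMellin_indicator_Ioc hb hs
  have h2 := hasMellin_indicator_Ioc ha hs
  have : mellin (fun x ↦ (Ioc (0 : ℝ) b).indicator (fun _ ↦ (1 : ℂ)) x -
      (Ioc (0 : ℝ) a).indicator (fun _ ↦ (1 : ℂ)) x) s =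
      mellin ((Ioc (0 : ℝ) b).indicator fun _ ↦ (1 : ℂ)) s -
        mellin ((Ioc (0 : ℝ) a).indicator fun _ ↦ (1 : ℂ)) s := by
    simp only [mellin, smul_sub]
    exact integral_sub h1.1 h2.1
  rw [this, h1.2, h2.2]
  ring

/-- **ONE-CELL NYMAN–BEURLING CRITERIA (⟹ RH, RH-free implication, empty FIN).**  For every
`0 < a < b ≤ 1`: if `𝟙_(a,b]` is an `L²(0,∞)`-limit of real combinations `∑_{k<N} c_k{1/((k+1)x)}`,
then RH holds — because `(b^s - a^s)/s ≠ 0` whenever `Re s > 0` (`|b^s| = b^{Re s} > a^{Re s}`),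
so no zero of `ζ` in `1/2 < Re s < 1` survives `mellin_eq_zero_of_nbTarget`.  For
`(a,b] = (1/(m+1), 1/m]` (and `(0,1/m]`) the converse holds under RH (Báez-Duarte/Balazard:
`B̄ = D ⟺ RH`), so each cell indicator gives an RH-EQUIVALENT; for `a, b` not both of the form
`1/m` the hypothesis is FALSE outright (every element of the closed span is `λ/x +` a function
constant on the cells `(1/(j+1),1/j]`), see the census card §20.
[cite: Balazard2020, Prop. 10 (i) and Prop. 11; BaezDuarte2003, Thm. 1.1] -/
theorem riemannHypothesis_of_nbTarget_indicator {a b : ℝ} (ha : 0 < a) (hab : a < b) (hb1 : b ≤ 1)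
    (h : ∀ ε : ℝ, 0 < ε → ∃ (N : ℕ) (c : Fin N → ℝ),
      eLpNorm (fun x : ℝ ↦ (Ioc a b).indicator 1 x -
          ∑ k : Fin N, c k * Int.fract (1 / (((k : ℕ) + 1 : ℝ) * x))) 2
        (volume.restrict (Ioi 0)) < ENNReal.ofReal ε) :
    RiemannHypothesis := by
  have hb : 0 < b := ha.trans hab
  refine riemannHypothesis_of_nbTarget (f := (Ioc a b).indicator 1)
    (measurable_one.indicator measurableSet_Ioc) ?_ ?_ ?_ h
  · -- `𝟙_(a,b] ∈ L²(0,∞)`: bounded by `1` and supported in a set of finite measure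
    have hfin : (volume.restrict (Ioi (0 : ℝ))) (Ioc a b) ≠ ⊤ := by
      rw [Measure.restrict_apply measurableSet_Ioc]
      exact ((measure_mono inter_subset_left).trans_lt measure_Ioc_lt_top).ne
    exact memLp_indicator_const 2 measurableSet_Ioc (1 : ℝ) (Or.inr hfin)
  · intro x hx
    exact indicator_of_notMem (fun h' : x ∈ Ioc a b ↦ absurd (h'.2.trans hb1) (not_le.2 hx)) _
  · intro s hs0 hs1 hmel
    have hre : 0 < s.re := by linarith
    have hs : s ≠ 0 := fun h' ↦ by simp [h'] at hre
    rw [mellin_indicator_Ioc ha hab hre, div_eq_zero_iff, sub_eq_zero] at hmel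
    rcases hmel with hmel | hmel
    · -- `b^s = a^s` is impossible: the norms are `b^{Re s} > a^{Re s}`
      have hn := congrArg (fun z : ℂ ↦ ‖z‖) hmel
      simp only [norm_cpow_eq_rpow_re_of_pos hb, norm_cpow_eq_rpow_re_of_pos ha] at hn
      have : a ^ s.re < b ^ s.re := Real.rpow_lt_rpow ha.le hab hre
      exact absurd hn this.ne'
    · exact absurd hmel hs

/-- Mellin transform of an initial segment, real-indicator spelling:
`∫_0^∞ 𝟙_(0,b](x) x^{s-1} dx = b^s/s` for `0 < b`, `0 < Re s`
(`Literature.NumberTheory.LFunctions.hasMellin_indicator_Ioc`). [folklore] -/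
theorem mellin_indicator_Ioc_zero {b : ℝ} (hb : 0 < b) {s : ℂ} (hs : 0 < s.re) :
    mellin (fun x ↦ (((Ioc (0 : ℝ) b).indicator 1 x : ℝ) : ℂ)) s = (b : ℂ) ^ s / s := by
  have hfun : (fun x ↦ (((Ioc (0 : ℝ) b).indicator 1 x : ℝ) : ℂ)) =
      (Ioc (0 : ℝ) b).indicator fun _ ↦ (1 : ℂ) := by
    funext x
    by_cases hxI : x ∈ Ioc (0 : ℝ) b
    · rw [indicator_of_mem hxI, indicator_of_mem hxI, Pi.one_apply, Complex.ofReal_one]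
    · rw [indicator_of_notMem hxI, indicator_of_notMem hxI, Complex.ofReal_zero]
  rw [hfun]
  exact (hasMellin_indicator_Ioc hb hs).2

/-- **INITIAL-SEGMENT NYMAN–BEURLING CRITERIA (⟹ RH, RH-free implication, empty FIN).**  For
every `0 < b ≤ 1`: if `𝟙_(0,b]` is an `L²(0,∞)`-limit of real combinations
`∑_{k<N} c_k{1/((k+1)x)}`, then RH holds (`mellin 𝟙_(0,b] = b^s/s` never vanishes).  For `b = 1`
this is the elementary half of Báez-Duarte's theorem (the tree's
`riemannHypothesis_of_beurling_closure`); for `b = 1/m` the converse holds under RH by dilation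
(`nbTarget_indicator_of_rh` in the companion file), so «`𝟙_(0,1/m] ∈ B̄`» is an RH-EQUIVALENT for
every `m ≥ 1`. [cite: BaezDuarte2003, Thm. 1.1; Balazard2020, Prop. 10 (i)] -/
theorem riemannHypothesis_of_nbTarget_indicator_zero {b : ℝ} (hb : 0 < b) (hb1 : b ≤ 1)
    (h : ∀ ε : ℝ, 0 < ε → ∃ (N : ℕ) (c : Fin N → ℝ),
      eLpNorm (fun x : ℝ ↦ (Ioc (0 : ℝ) b).indicator 1 x -
          ∑ k : Fin N, c k * Int.fract (1 / (((k : ℕ) + 1 : ℝ) * x))) 2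
        (volume.restrict (Ioi 0)) < ENNReal.ofReal ε) :
    RiemannHypothesis := by
  refine riemannHypothesis_of_nbTarget (f := (Ioc (0 : ℝ) b).indicator 1)
    (measurable_one.indicator measurableSet_Ioc) ?_ ?_ ?_ h
  · have hfin : (volume.restrict (Ioi (0 : ℝ))) (Ioc 0 b) ≠ ⊤ := by
      rw [Measure.restrict_apply measurableSet_Ioc]
      exact ((measure_mono inter_subset_left).trans_lt measure_Ioc_lt_top).ne
    exact memLp_indicator_const 2 measurableSet_Ioc (1 : ℝ) (Or.inr hfin)
  · intro x hx
    exact indicator_of_notMem (fun h' : x ∈ Ioc (0 : ℝ) b ↦ absurd (h'.2.trans hb1) (not_le.2 hx)) _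
  · intro s hs0 _ hmel
    have hre : 0 < s.re := by linarith
    have hs : s ≠ 0 := fun h' ↦ by simp [h'] at hre
    rw [mellin_indicator_Ioc_zero hb hre, div_eq_zero_iff] at hmel
    rcases hmel with hmel | hmel
    · have hn := congrArg (fun z : ℂ ↦ ‖z‖) hmel
      simp only [norm_cpow_eq_rpow_re_of_pos hb, norm_zero] at hn
      exact absurd hn (Real.rpow_pos_of_pos hb _).ne'
    · exact absurd hmel hs

end Summit.RiemannHypothesis.RiemannHypothesis.Theorems.Splittings.NbTargets
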